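import Summits.CriticalPhenomena.PercolationContinuityZ3.Theorems.PercNearOneGluingNoHeavyLowerTailKnQuestion8CoefficientwiseRootEdgeDomination
import Summits.CriticalPhenomena.PercolationContinuityZ3.Theorems.PercNearOneGluingNoHeavyLowerTailKnQuestion8CoefficientwiseLeakNoCoreFree
import HarnessLib

/-!
# Root-edge domination for a SINGLE target is a theorem: given no core at `y` and a red root edge, the red cluster of `x` dominates the blue one — prim-lf-2 gen 66

Support file (`--supports stmt-CriticalPhenomena-4575`, closed), prover `prim-lf-2` (gen 66).  No definitions, no named facts, no sorries; standard axioms.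
Memo `prim-lf-2/CW-BASE-gen66.md` §7.6–7.9.  Assembles `rem_nonneg_of_leak` ((L) ⟹ (REM), `…CoefficientwiseRootEdgeDomination.lean`) with THEOREM (L′) (`leak_blue_dominates_red_sub`,
`…CoefficientwiseLeakNoCoreFree.lean`).

Setting: finite multigraph `ends : ι → Sym2 V`, edge set `E`, root `x`, `C_v(s) = openCluster (ends '' s) v`; CONJECTURE NO-CORE (prim-lf-2 gen 46) is
`Σ_{s : ¬(y ∈ C_x(s) ∧ y ∈ C_x(E∖s))} (f(C_x s) − f(C_x(E∖s)))(g(…) − g(…)) ≥ 0`.  Its linear 'root-edge shadow' — the case `W = {y}` of gen 66's CONJECTURE (REM) — is settled here: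
* `Coefficientwise.rem_nonneg_of_single_target` — **THEOREM**: for every root edge `e ∈ E` (ends `{x,p}`, `p ≠ x`), every vertex `y` and every monotone `g`,
  `0 ≤ Σ_{s ⊆ E : e ∈ s, ¬(y ∈ C_x s ∧ y ∈ C_x(E∖s))} (g(C_x s) − g(C_x(E∖s)))` — on the no-core event at `y`, a red root edge makes the red cluster of `x` stochastically dominate the
  blue one.
KEY REMARK (memo §7.9): in the leak lemma (L) (hypothesis of `rem_nonneg_of_leak`) the leaking target lies in the red cluster `P` of `p`, hence — as `p ∉ C_x(t)` — outside `C_x(t)`, so its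
own no-core condition is automatic; for a single target the no-core side condition of (L) is therefore void and (L) coincides with the theorem (L′).  For target SETS the side condition
on the OTHER targets remains (memo §7.8: the open atom L_gad = PART1 + PART2).
[cite: KozmaNitzan2024, Questions 8–9 (§5.5 p. 36) (context: the Question-8 pocket covariance programme)]
-/

namespace Summit.CriticalPhenomena.PercolationContinuityZ3.Theorems

open Finset Literature.Probability.Percolation

namespace Coefficientwise

variable {ι V : Type*} [DecidableEq ι] (ends : ι → Sym2 V)

open Classical in
/-- **THEOREM — root-edge domination on the single-target no-core event.**  For a root edge `e ∈ E` with ends `{x,p}` (`p ≠ x`), any vertex `y` and any monotone `g`: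
`0 ≤ Σ_{s ⊆ E : e ∈ s, ¬(y ∈ C_x s ∧ y ∈ C_x(E∖s))} (g(C_x s) − g(C_x(E∖s)))`.  [cite: KozmaNitzan2024, Questions 8–9 (§5.5 p. 36) (context)] -/
theorem rem_nonneg_of_single_target (E : Finset ι) {e : ι} (he : e ∈ E) {x p : V} (hxp : ends e = s(x, p)) (hpx : p ≠ x)
    (y : V) (g : Set V → ℝ) (hg : Monotone g) :
    0 ≤ ∑ s ∈ E.powerset.filter (fun s : Finset ι => e ∈ s ∧
          ∀ w ∈ ({y} : Set V), ¬ (w ∈ openCluster (ends '' (↑s : Set ι)) x ∧ w ∈ openCluster (ends '' (↑(E \ s) : Set ι)) x)),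
      (g (openCluster (ends '' (↑s : Set ι)) x) - g (openCluster (ends '' (↑(E \ s) : Set ι)) x)) := by
  refine rem_nonneg_of_leak ends E he hxp hpx ({y} : Set V) g hg ?_
  set E' : Finset ι := E.erase e with hE'
  -- for the single target `y` the no-core side condition of (L) is implied by the leak condition
  have hfilter : (E'.powerset.filter (fun t : Finset ι =>
        p ∉ openCluster (ends '' (↑t : Set ι)) x ∧
        (∀ w ∈ ({y} : Set V), ¬ (w ∈ openCluster (ends '' (↑t : Set ι)) x ∧ w ∈ openCluster (ends '' (↑(E' \ t) : Set ι)) x)) ∧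
        (∃ w ∈ ({y} : Set V), w ∈ openCluster (ends '' (↑t : Set ι)) p ∧ w ∈ openCluster (ends '' (↑(E' \ t) : Set ι)) x))) =
      (E'.powerset.filter (fun t : Finset ι =>
        p ∉ openCluster (ends '' (↑t : Set ι)) x ∧
        (∃ w ∈ ({y} : Set V), w ∈ openCluster (ends '' (↑t : Set ι)) p ∧ w ∈ openCluster (ends '' (↑(E' \ t) : Set ι)) x))) := by
    refine Finset.filter_congr fun t _ => ?_
    constructor
    · rintro ⟨h1, -, h3⟩; exact ⟨h1, h3⟩
    · rintro ⟨h1, h3⟩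
      refine ⟨h1, fun w hw hwc => ?_, h3⟩
      obtain ⟨w', hw', hw'P, -⟩ := h3
      have hwy : w = y := Set.mem_singleton_iff.mp hw
      have hw'y : w' = y := Set.mem_singleton_iff.mp hw'
      -- `y ∈ C_x(t)` and `y ∈ C_p(t)` would put `p` in `C_x(t)`
      have hyP : w ∈ openCluster (ends '' (↑t : Set ι)) p := by rw [hwy, ← hw'y]; exact hw'P
      exact h1 (SimpleGraph.Reachable.trans hwc.1 (SimpleGraph.Reachable.symm hyP))
  rw [hfilter]
  exact leak_blue_dominates_red_sub ends E' x p ({y} : Set V) g hg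

end Coefficientwise

end Summit.CriticalPhenomena.PercolationContinuityZ3.Theorems
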